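import Mathlib.Analysis.SpecialFunctions.Sqrt
import Mathlib.Analysis.Calculus.Deriv.MeanValue
import Mathlib.Analysis.Calculus.Deriv.Inv
import Mathlib.Analysis.Calculus.Deriv.Pow
import Literature.Analysis.SpecialFunctions.ArcsinPowerSeries

/-!
# SoloInformed — tilt and apex bounds for nearly flat spacelike graphs (the analytic core of (G8))

Soloist `solo-FinalStateConjecture-informed` (session 10, 2026-08-19). Pure real analysis, no geometry
imported: the one-variable comparison lemma that drives the soloist's TILT-RIGIDITY argument
(paper/TILT.md, (G8)) closing the "lateness loophole" (G7-C) of the typed `N = 0` final-state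
decomposition for collapse developments with a flat pre-collapse region.

Setting. A late flat leaf of a typed `N = 0` decomposition is, inside an exactly flat region of the
development, a spacelike graph `t = f(x)` over Cartesian coordinates with `|∇f| < 1` and second
fundamental form `|A| ≤ ε` (from the unweighted `C¹` part of `deviationCk … 2`). Restricting `f` to a
coordinate ray `s ↦ x₀ + s e` gives `g(s) = f(x₀ + s e)` with `|g'| < 1` and
`|g''| ≤ ε (1 - g'²)^{3/2}` (since `|A(ê, ê)| ≤ |A| g(ê, ê)`, `A(ê, ê) = g'' / √(1 - |∇f|²)` and
`1 - |∇f|² ≤ 1 - g'²`). For such `g`: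

* `hypSlope_ge_sub` (TILT LEMMA): the hyperbolic slope `σ(s) = g'(s)/√(1 - g'(s)²) = sinh(rapidity)`
  is `ε`-Lipschitz from below: `σ(s) ≥ σ(0) - ε s` on `[0, S]` (its derivative is `g''/(1 - g'²)^{3/2}`).
* `height_ge_of_hypSlope_nonneg` (HEIGHT LEMMA): if `g'(0) ≥ 0` then
  `g(S) ≥ g(0) - (√(1 + (ε S)²) - 1)/ε` — the graph cannot drop faster than the hyperboloid of
  curvature `ε` touching it at `s = 0`.
* `apex_le` (APEX BOUND): if moreover `g(s) < a - s` for all `s ≥ 0` (the ray stays in the past cone of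
  the event `(t, s) = (a, 0)` of the `2`-plane), then `g(0) ≤ a - 1/ε`. Sharp (hyperbola
  `g(s) = a - √(ε⁻² + s²)`). Choosing, at any point `x₀` of a complete leaf `L ⊂ I⁻(p)`, a ray direction
  `e ⊥ x₀ - p⃗` with `e · ∇f(x₀) ≥ 0` (possible in dimension `≥ 3`) this gives the global statement
  `L ⊂ {q : d(q, p) ≥ 1/ε}` — the `|A|`-version (elementary, ODE comparison) of the mean-curvature
  estimate of Aledo–Alías (manuscripta math. 101 (2000), Thm. 1) and Alías–Hurtado–Palmer
  (Trans. AMS 362 (2010), Thm. 4.2 / Cor. 4.3: `sup H ≥ 1 / inf d_p` for complete spacelike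
  hypersurfaces in `I⁺(p)` satisfying the Omori–Yau principle), which is the nearest published result;
  what (G8) uses is the LOCALISED form `hypSlope_ge_sub` along rays of bounded length, which has no
  completeness hypothesis.

References: [AledoAlias2000] Thm. 1; [AliasHurtadoPalmer2010] Thm. 4.2, Cor. 4.3; [ONeill1983] Ch. 5
(hyperbolic angle), Ch. 4 (shape operator of a hypersurface).
-/

open Set Real

set_option linter.dupNamespace false

namespace Summit.FinalStateConjecture.FinalStateConjecture.Theorems

/-- **Derivative of the hyperbolic slope along a ray.** If `g'` has derivative `g''(s)` at `s` and
`|g'(s)| < 1`, then `x ↦ g'(x)/√(1 - g'(x)²)` has derivative `g''(s)/√(1 - g'(s)²)³` at `s`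
(`= g''/(1 - g'²)^{3/2}`, the normal curvature of the graph in the ray direction divided by
`√(1 - g'²) ≥ √(1 - |∇f|²)`). [cite: ONeill1983, Ch. 4  p. 107 (shape operator)] -/
theorem hasDerivAt_hypSlope {g' g'' : ℝ → ℝ} {s : ℝ} (hd : HasDerivAt g' (g'' s) s)
    (h1 : |g' s| < 1) :
    HasDerivAt (fun x ↦ g' x / √(1 - g' x ^ 2)) (g'' s / √(1 - g' s ^ 2) ^ 3) s := by
  have hpos : 0 < 1 - g' s ^ 2 := Literature.Analysis.SpecialFunctions.one_sub_sq_pos_of_abs_lt_one h1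
  have hv : 0 < √(1 - g' s ^ 2) := Real.sqrt_pos.mpr hpos
  have hvsq : √(1 - g' s ^ 2) ^ 2 = 1 - g' s ^ 2 := Real.sq_sqrt hpos.le
  have hA : HasDerivAt (fun x ↦ 1 - g' x ^ 2) (-(2 * g' s * g'' s)) s := by
    have h2 : HasDerivAt (fun x ↦ g' x ^ 2) (2 * g' s * g'' s) s := by
      simpa using hd.fun_pow 2
    simpa using h2.const_sub 1
  have hB : HasDerivAt (fun x ↦ √(1 - g' x ^ 2))
      (-(2 * g' s * g'' s) / (2 * √(1 - g' s ^ 2))) s := hA.sqrt hpos.ne'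
  have hC := hd.div hB hv.ne'
  refine hC.congr_deriv ?_
  -- algebra: eliminate `g' s ^ 2 = 1 - v ^ 2`, then a pure field identity in `v`.
  set v : ℝ := √(1 - g' s ^ 2) with hvdef
  have hv0 : v ≠ 0 := hv.ne'
  have ht : g' s ^ 2 = 1 - v ^ 2 := by linarith
  have e : g' s * (-(2 * g' s * g'' s) / (2 * v)) = -((1 - v ^ 2) * g'' s / v) := by
    rw [← ht]
    field_simp
  rw [e]
  field_simp
  ring

/-- **Tilt lemma** (the hyperbolic slope is `ε`-Lipschitz from below). On `[0, S]` let `g'` have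
derivative `g''`, `|g'| < 1` and `|g''| ≤ ε (1 - g'²) √(1 - g'²)`. Then
`g'(0)/√(1 - g'(0)²) - ε s ≤ g'(s)/√(1 - g'(s)²)` for every `s ∈ [0, S]`: along a coordinate ray in a flat
region, the rapidity `θ` of a spacelike graph with second fundamental form `|A| ≤ ε` obeys
`|d(sinh θ)/ds| ≤ ε`. [cite: AliasHurtadoPalmer2010, Thm. 4.2 (nearest published estimate; this localised form is elementary)] -/
theorem hypSlope_ge_sub {ε S : ℝ} {g' g'' : ℝ → ℝ}
    (hd : ∀ s ∈ Icc 0 S, HasDerivAt g' (g'' s) s) (h1 : ∀ s ∈ Icc 0 S, |g' s| < 1)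
    (h2 : ∀ s ∈ Icc 0 S, |g'' s| ≤ ε * (1 - g' s ^ 2) * √(1 - g' s ^ 2)) :
    ∀ s ∈ Icc 0 S, g' 0 / √(1 - g' 0 ^ 2) - ε * s ≤ g' s / √(1 - g' s ^ 2) := by
  -- `w(x) = σ(x) + ε x` is monotone on `[0, S]` since `w' = g''/√(1-g'²)³ + ε ≥ 0`.
  set w : ℝ → ℝ := fun x ↦ g' x / √(1 - g' x ^ 2) + ε * x with hw
  have hderiv : ∀ x ∈ Icc 0 S, HasDerivAt w (g'' x / √(1 - g' x ^ 2) ^ 3 + ε) x := by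
    intro x hx
    have h := hasDerivAt_hypSlope (hd x hx) (h1 x hx)
    have h' : HasDerivAt (fun y ↦ ε * y) ε x := by
      simpa using (hasDerivAt_id x).const_mul ε
    exact h.add h'
  have hnonneg : ∀ x ∈ Icc 0 S, 0 ≤ g'' x / √(1 - g' x ^ 2) ^ 3 + ε := by
    intro x hx
    have hpos : 0 < 1 - g' x ^ 2 := Literature.Analysis.SpecialFunctions.one_sub_sq_pos_of_abs_lt_one (h1 x hx)
    have hv : 0 < √(1 - g' x ^ 2) := Real.sqrt_pos.mpr hpos
    have hvsq : √(1 - g' x ^ 2) ^ 2 = 1 - g' x ^ 2 := Real.sq_sqrt hpos.le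
    have hv3 : 0 < √(1 - g' x ^ 2) ^ 3 := by positivity
    have hcube : √(1 - g' x ^ 2) ^ 3 = (1 - g' x ^ 2) * √(1 - g' x ^ 2) := by
      rw [pow_succ, hvsq]
    have hb : -(ε * √(1 - g' x ^ 2) ^ 3) ≤ g'' x := by
      have := (abs_le.mp (h2 x hx)).1
      rw [hcube]
      linarith
    have : -ε ≤ g'' x / √(1 - g' x ^ 2) ^ 3 := by
      rw [le_div_iff₀ hv3]
      linarith
    linarith
  have hmono : MonotoneOn w (Icc 0 S) := by
    apply monotoneOn_of_deriv_nonneg (convex_Icc 0 S)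
    · intro x hx
      exact (hderiv x hx).continuousAt.continuousWithinAt
    · intro x hx
      have hx' : x ∈ Icc 0 S := interior_subset hx
      exact (hderiv x hx').differentiableAt.differentiableWithinAt
    · intro x hx
      have hx' : x ∈ Icc 0 S := interior_subset hx
      rw [(hderiv x hx').deriv]
      exact hnonneg x hx'
  intro s hs
  have h0 : (0 : ℝ) ∈ Icc 0 S := ⟨le_rfl, hs.1.trans hs.2⟩
  have := hmono h0 hs hs.1
  simp only [hw, mul_zero, add_zero] at this
  linarith

/-- From a lower bound on the hyperbolic slope to a lower bound on the slope:
`p/√(1 - p²) ≥ -t` with `t ≥ 0`, `|p| < 1` gives `p ≥ -t/√(1 + t²)` (`tanh ∘ arsinh` is monotone).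
[cite: ONeill1983, Ch. 5  p. 144 (hyperbolic angle)] -/
theorem slope_ge_of_hypSlope_ge {p t : ℝ} (hp : |p| < 1) (ht : 0 ≤ t)
    (h : -t ≤ p / √(1 - p ^ 2)) : -(t / √(1 + t ^ 2)) ≤ p := by
  by_cases hp0 : 0 ≤ p
  · have : 0 ≤ t / √(1 + t ^ 2) := by positivity
    linarith
  · push Not at hp0
    have hpos : 0 < 1 - p ^ 2 := Literature.Analysis.SpecialFunctions.one_sub_sq_pos_of_abs_lt_one hp
    have hv : 0 < √(1 - p ^ 2) := Real.sqrt_pos.mpr hpos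
    have hvsq : √(1 - p ^ 2) ^ 2 = 1 - p ^ 2 := Real.sq_sqrt hpos.le
    -- `-p ≤ t √(1 - p²)`, both sides nonnegative; square.
    have h3 : -p ≤ t * √(1 - p ^ 2) := by
      have := (le_div_iff₀ hv).mp h
      linarith
    have h4 : p ^ 2 ≤ t ^ 2 * (1 - p ^ 2) := by
      have hnn : 0 ≤ -p := by linarith
      have := mul_le_mul h3 h3 hnn (by positivity)
      nlinarith [hvsq, this]
    have h5 : p ^ 2 ≤ t ^ 2 / (1 + t ^ 2) := by
      rw [le_div_iff₀ (by positivity)]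
      nlinarith [h4]
    have h6 : |p| ≤ t / √(1 + t ^ 2) := by
      calc |p| = √(p ^ 2) := (Real.sqrt_sq_eq_abs p).symm
        _ ≤ √(t ^ 2 / (1 + t ^ 2)) := Real.sqrt_le_sqrt h5
        _ = t / √(1 + t ^ 2) := by rw [Real.sqrt_div (sq_nonneg t), Real.sqrt_sq ht]
    exact (abs_le.mp h6).1

/-- **Height lemma.** On `[0, S]` (`S ≥ 0`, `ε > 0`) let `g` have derivative `g'`, `g'` have derivative
`g''`, `|g'| < 1`, `|g''| ≤ ε (1 - g'²) √(1 - g'²)` and `g'(0) ≥ 0`. Then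
`g(0) - (√(1 + (ε S)²) - 1)/ε ≤ g(S)`: a spacelike graph with second fundamental form at most `ε` in a
flat region drops, along a ray leaving a point of nonnegative slope, at most as fast as the hyperboloid
of curvature `ε`. [cite: AledoAlias2000, Thm. 1 (hyperboloids as the extremal comparison hypersurfaces)] -/
theorem height_ge_of_hypSlope_nonneg {ε S : ℝ} {g g' g'' : ℝ → ℝ} (hε : 0 < ε) (hS : 0 ≤ S)
    (hg : ∀ s ∈ Icc 0 S, HasDerivAt g (g' s) s) (hd : ∀ s ∈ Icc 0 S, HasDerivAt g' (g'' s) s)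
    (h1 : ∀ s ∈ Icc 0 S, |g' s| < 1)
    (h2 : ∀ s ∈ Icc 0 S, |g'' s| ≤ ε * (1 - g' s ^ 2) * √(1 - g' s ^ 2)) (h0 : 0 ≤ g' 0) :
    g 0 - (√(1 + (ε * S) ^ 2) - 1) / ε ≤ g S := by
  -- `H(x) = g(x) + (√(1 + (ε x)²) - 1)/ε` is monotone on `[0, S]`.
  set H : ℝ → ℝ := fun x ↦ g x + (√(1 + (ε * x) ^ 2) - 1) / ε with hH
  have hslope : ∀ x ∈ Icc 0 S, -(ε * x / √(1 + (ε * x) ^ 2)) ≤ g' x := by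
    intro x hx
    have hσ := hypSlope_ge_sub hd h1 h2 x hx
    have hσ0 : 0 ≤ g' 0 / √(1 - g' 0 ^ 2) := by
      have h00 : (0 : ℝ) ∈ Icc 0 S := ⟨le_rfl, hS⟩
      have := Real.sqrt_pos.mpr (Literature.Analysis.SpecialFunctions.one_sub_sq_pos_of_abs_lt_one (h1 0 h00))
      positivity
    have hεx : 0 ≤ ε * x := mul_nonneg hε.le hx.1
    have h' : -(ε * x) ≤ g' x / √(1 - g' x ^ 2) := by linarith
    exact slope_ge_of_hypSlope_ge (h1 x hx) hεx h'
  have hderiv : ∀ x ∈ Icc 0 S,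
      HasDerivAt H (g' x + ε * x / √(1 + (ε * x) ^ 2)) x := by
    intro x hx
    have hin : HasDerivAt (fun y ↦ 1 + (ε * y) ^ 2) (2 * (ε * x) * ε) x := by
      have h := ((hasDerivAt_id x).const_mul ε).fun_pow 2
      have h' : HasDerivAt (fun y ↦ (ε * y) ^ 2) (2 * (ε * x) * ε) x := by
        simpa using h
      simpa using h'.const_add 1
    have hpos : 0 < 1 + (ε * x) ^ 2 := by positivity
    have hsq : HasDerivAt (fun y ↦ √(1 + (ε * y) ^ 2))
        (2 * (ε * x) * ε / (2 * √(1 + (ε * x) ^ 2))) x := hin.sqrt hpos.ne'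
    have hF : HasDerivAt (fun y ↦ (√(1 + (ε * y) ^ 2) - 1) / ε)
        (2 * (ε * x) * ε / (2 * √(1 + (ε * x) ^ 2)) / ε) x := (hsq.sub_const 1).div_const ε
    have hsum := (hg x hx).add hF
    refine hsum.congr_deriv ?_
    have hr : √(1 + (ε * x) ^ 2) ≠ 0 := (Real.sqrt_pos.mpr hpos).ne'
    have hε0 : ε ≠ 0 := hε.ne'
    field_simp
  have hmono : MonotoneOn H (Icc 0 S) := by
    apply monotoneOn_of_deriv_nonneg (convex_Icc 0 S)
    · intro x hx
      exact (hderiv x hx).continuousAt.continuousWithinAt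
    · intro x hx
      exact (hderiv x (interior_subset hx)).differentiableAt.differentiableWithinAt
    · intro x hx
      have hx' : x ∈ Icc 0 S := interior_subset hx
      rw [(hderiv x hx').deriv]
      have := hslope x hx'
      linarith
  have h0S : (0 : ℝ) ∈ Icc 0 S := ⟨le_rfl, hS⟩
  have hSS : S ∈ Icc 0 S := ⟨hS, le_rfl⟩
  have := hmono h0S hSS hS
  simp only [hH, mul_zero] at this
  norm_num at this
  linarith

/-- `√(1 + y²) ≤ y + 1/(2y)` for `y > 0` (the hyperboloid lies below its asymptote plus `1/(2y)`).
[cite: AledoAlias2000, Thm. 1 (hyperboloid asymptotics)] -/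
theorem sqrt_one_add_sq_le {y : ℝ} (hy : 0 < y) : √(1 + y ^ 2) ≤ y + 1 / (2 * y) := by
  have hnn : 0 ≤ y + 1 / (2 * y) := by positivity
  have hle : 1 + y ^ 2 ≤ (y + 1 / (2 * y)) ^ 2 := by
    have : (y + 1 / (2 * y)) ^ 2 = y ^ 2 + 1 + 1 / (4 * y ^ 2) := by
      field_simp
      ring
    rw [this]
    have : 0 ≤ 1 / (4 * y ^ 2) := by positivity
    linarith
  calc √(1 + y ^ 2) ≤ √((y + 1 / (2 * y)) ^ 2) := Real.sqrt_le_sqrt hle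
    _ = y + 1 / (2 * y) := Real.sqrt_sq hnn

/-- **Apex bound** (sharp). Let `g` be defined on `[0, ∞)` with `g'`, `g''` as above for every `S ≥ 0`:
`|g'| < 1`, `|g''| ≤ ε (1 - g'²) √(1 - g'²)`, `g'(0) ≥ 0`, `ε > 0`, and suppose the ray stays in the
open past cone of the event at height `a` above its starting point: `g(s) < a - s` for all `s ≥ 0`. Then
`g(0) ≤ a - 1/ε`. Equality is attained by `g(s) = a - √(ε⁻² + s²)`. Geometric reading: a complete
spacelike hypersurface with `|A| ≤ ε` inside `I⁻(p)` in Minkowski space keeps Lorentzian distance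
`≥ 1/ε` from `p` (cf. Alías–Hurtado–Palmer, Trans. AMS 362 (2010), Cor. 4.3, with the mean curvature in
place of `|A|` under the Omori–Yau principle). [cite: AliasHurtadoPalmer2010, Thm. 4.2  Cor. 4.3] -/
theorem apex_le {ε a : ℝ} {g g' g'' : ℝ → ℝ} (hε : 0 < ε)
    (hg : ∀ s, 0 ≤ s → HasDerivAt g (g' s) s) (hd : ∀ s, 0 ≤ s → HasDerivAt g' (g'' s) s)
    (h1 : ∀ s, 0 ≤ s → |g' s| < 1)
    (h2 : ∀ s, 0 ≤ s → |g'' s| ≤ ε * (1 - g' s ^ 2) * √(1 - g' s ^ 2)) (h0 : 0 ≤ g' 0)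
    (hcone : ∀ s, 0 ≤ s → g s < a - s) :
    g 0 ≤ a - 1 / ε := by
  refine le_of_forall_pos_lt_add fun η hη ↦ ?_
  -- take `S = 1/(2 ε² η)`; then `g 0 < a - 1/ε + 1/(2 ε² S) = a - 1/ε + η`.
  set S : ℝ := 1 / (2 * ε ^ 2 * η) with hSdef
  have hS : 0 < S := by positivity
  have hIcc : ∀ {P : ℝ → Prop}, (∀ s, 0 ≤ s → P s) → ∀ s ∈ Icc 0 S, P s :=
    fun h s hs ↦ h s hs.1
  have hheight := height_ge_of_hypSlope_nonneg hε hS.le (hIcc hg) (hIcc hd) (hIcc h1) (hIcc h2) h0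
  have hc := hcone S hS.le
  have hεS : 0 < ε * S := by positivity
  have hsq := sqrt_one_add_sq_le hεS
  have hkey : (ε * S + 1 / (2 * (ε * S)) - 1) / ε = S - 1 / ε + η := by
    rw [hSdef]
    field_simp
    ring
  have hmono : (√(1 + (ε * S) ^ 2) - 1) / ε ≤ (ε * S + 1 / (2 * (ε * S)) - 1) / ε :=
    div_le_div_of_nonneg_right (by linarith) hε.le
  linarith

end Summit.FinalStateConjecture.FinalStateConjecture.Theorems
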